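/-
Copyright (c) 2026 the pub-hodgecm-mathlib formalisation cell (harness21).  Prover seat hodgecm-mathlib-K2E4-p11 (g8): Track B «K2-LIT»,
#184♮ = hLiu418 = stmt-HodgeConjecture-24832; socket #41 road (R-c), SECOND HAND with LH4-p17 (g2) (LEAD F0P6-plan (g14) BATCH #123 (2)): the letter `hadapt` of
★ p862904 I4 ED. 6 at and around a Levi-adapted standard reference datum.  THEOREMS ONLY (no `def`, no `instance`, no `notation`, no named-fact hypothesis, no `sorry`).
-/
import Summits.HodgeConjecture.HodgeConjecture.Theorems.K2LiuTensorEmbArchFinParts         -- ★ `IsStd.archToAdelic_archPart_mem` ((P0): `(k_∞,1) ∈ 𝒦.K`)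
import Summits.HodgeConjecture.HodgeConjecture.Theorems.K2LiuSiegelDoubledLeviMatrix            -- ★ `blk`, `cayR`, `cayRinv`, `gramR` (the chart's block equation)
import Summits.HodgeConjecture.HodgeConjecture.Theorems.K2LiuSiegelDoubledIwasawaCompact        -- ★ `standardMaximalCompactGL`
import HarnessLib

/-!
# Crux `HLiu418`, socket #41, road (R-c) — `K2LiuLeviAdaptedDatumArchK`: THE ARCHIMEDEAN LEVI-ADAPTEDNESS LETTER `hadapt` ON THE ARCHIMEDEAN CLASS OF A
# LEVI-ADAPTED STANDARD DATUM

Cell `hodgecm-mathlib`, crux item hLiu418 = `stmt-HodgeConjecture-24832`; squad K2 ∕ K2Liu (L1, LEAD F0P6-plan (g14)), road `K2_Liu`, socket #41, RULING M-158j road (R-c);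
consumers: the #41 tie (K2E3-typ2 (g2) ∕ the TOP's K2E5-p17 lineage) through ★ p862794 `continuation_of_archReference`'s hypothesis `h41` and ★ p862904 I4 ED. 6's letter
`hadapt`.  Lane `--supports stmt-HodgeConjecture-24832 --as helper` (count-neutral helper; closes no socket by itself).  General `n`.

THE MATHEMATICS [BorelJacquet1979, §1.1, §4.1], [MoeglinWaldspurger1995, I.1.4, II.1.7], [PlatonovRapinchuk1994, §3.3, §5.1].  A standard Iwasawa datum `𝒦` is a PRODUCT
`C_∞ × C_f` ((P0) of `IsStd`), so the archimedean component `(k_∞, 1)` of a member `k ∈ 𝒦.K` is again a member (★ `IsStd.archToAdelic_archPart_mem`).  If a standard reference datum `𝒦₁` is LEVI-ADAPTED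
for the standard compact of `GL_n` — `Λ(K_{GL_n}) ⊆ 𝒦₁.K` for every Levi chart `Λ` (LH4-p17's `exists_isStd_leviAdapted`: at the tree's `K₉`, `S₉⁻¹ Λ(g) S₉ = diag(g, w σ(g⁻¹)ᵀ w)`)
— then for EVERY standard `𝒦'` with the same archimedean trace (`(a,1) ∈ 𝒦'.K ↔ (a,1) ∈ 𝒦₁.K`, the class moved around by ★ p862794) the ARCHIMEDEAN adaptedness
`((Λ k)_∞, 1) ∈ 𝒦'.K` (`k ∈ K_{GL_n}`) holds (§2), which is literally ★ p862786's `harchK` and, quantified over the chart, ★ p862904 ED. 6's `hadapt` (§3 HEAD).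
* (§1 = ★ `K2LiuTensorEmbArchFinParts.IsStd.archToAdelic_archPart_mem`, imported); §2 `arch_mem_of_full`; §3 HEAD **`hadapt_of_leviAdapted`**.
HONEST LABEL.  Count-neutral helper; it retires nothing by itself: `HC_CM` is proved only modulo the 7 printed citations (2 remaining named inputs:
hLiu418 = `stmt-HodgeConjecture-24832`, h413 = `stmt-HodgeConjecture-24833`) until rung 0 closes.

## References
* [BorelJacquet1979] A. Borel, H. Jacquet, *Automorphic forms and automorphic representations*, Corvallis I (1979), §1.1, §4.1.
* [MoeglinWaldspurger1995] C. Mœglin, J.-L. Waldspurger, *Spectral decomposition and Eisenstein series* (1995), I.1.4, II.1.7.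
* [PlatonovRapinchuk1994] V. Platonov, A. Rapinchuk, *Algebraic Groups and Number Theory* (1994), §3.3, §5.1.
-/

set_option autoImplicit false
set_option linter.dupNamespace false -- the mandated namespace repeats `HodgeConjecture.HodgeConjecture`

noncomputable section

open scoped Matrix
open NumberField IsDedekindDomain
open Literature.NumberTheory.Automorphic Literature.NumberTheory.Automorphic.UnitaryGroup Literature.NumberTheory.GaloisRepresentations
open Literature.NumberTheory.GelbartRogawski1991 Literature.NumberTheory.GelbartRogawski1991.GRConstruction
open Literature.NumberTheory.GelbartRogawski1991.AdaptedBlocks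
open Literature.NumberTheory.K2Lit.SiegelDoubled
open Summit.HodgeConjecture.HodgeConjecture.Cruxes.HLiu418.K2LiuTensorEmbArchFinParts (IsStd.archToAdelic_archPart_mem)

namespace Summit.HodgeConjecture.HodgeConjecture.Cruxes.HLiu418.K2LiuLeviAdaptedDatumArchK

variable (L : Type) [Field L] [NumberField L] [IsCMField L]
variable {N M n : ℕ} (e : Fin N × Fin M ≃ Fin n)
  (dV : Fin N → L) (hdV : ∀ i, IsCMField.complexConj L (dV i) = dV i)
  (dW : Fin M → L) (hdW : ∀ i, IsCMField.complexConj L (dW i) = dW i)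

/-! ## §2 Archimedean adaptedness on the archimedean class of a fully adapted datum -/

/-- **ARCHIMEDEAN ADAPTEDNESS ON THE CLASS**: if `Λ(K_{GL_n}) ⊆ 𝒦₁.K` for a standard `𝒦₁` and `𝒦'` has the same archimedean trace as `𝒦₁` (`(a,1) ∈ 𝒦'.K ↔ (a,1) ∈ 𝒦₁.K`),
then `((Λ k)_∞, 1) ∈ 𝒦'.K` for every `k ∈ K_{GL_n}` — ★ p862786 `exists_preimageLevel`'s `harchK` for `𝒦'`. [cite: BorelJacquet1979, §4.1] [cite: MoeglinWaldspurger1995, II.1.7] -/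
theorem arch_mem_of_full {𝒦₁ : IwasawaDatum L e dV hdV dW hdW} (h₁ : 𝒦₁.IsStd) (Λ : GL (Fin n) (AdeleRing (𝓞 L) L) →* HA L e dV hdV dW hdW)
    (hfull : ∀ k : GL (Fin n) (AdeleRing (𝓞 L) L), k ∈ standardMaximalCompactGL n L → Λ k ∈ 𝒦₁.K)
    {𝒦' : IwasawaDatum L e dV hdV dW hdW}
    (harch : ∀ a : UnitaryGroup.arch (Fp L) L (IsCMField.complexConj L) (n + n) (hermD L e dV hdV dW hdW),
      (UnitaryGroup.archToAdelic (Fp L) L (IsCMField.complexConj L) (n + n) (hermD L e dV hdV dW hdW) a : HA L e dV hdV dW hdW) ∈ 𝒦'.K ↔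
        (UnitaryGroup.archToAdelic (Fp L) L (IsCMField.complexConj L) (n + n) (hermD L e dV hdV dW hdW) a : HA L e dV hdV dW hdW) ∈ 𝒦₁.K) :
    ∀ k : ↥(standardMaximalCompactGL n L),
      (UnitaryGroup.archToAdelic (Fp L) L (IsCMField.complexConj L) (n + n) (hermD L e dV hdV dW hdW)
        (UnitaryGroup.archPart (Fp L) L (IsCMField.complexConj L) (n + n) (hermD L e dV hdV dW hdW) (Λ (k : GL (Fin n) (AdeleRing (𝓞 L) L)))) :
          HA L e dV hdV dW hdW) ∈ 𝒦'.K :=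
  fun k => (harch _).2 (IsStd.archToAdelic_archPart_mem L e dV hdV dW hdW h₁ (hfull k k.2))

/-! ## §3 HEAD: ★ I4 ED. 6's letter `hadapt` on the archimedean class of a Levi-adapted standard datum -/

/-- **HEAD — `hadapt` OF ★ p862904 I4 ED. 6 ON THE ARCHIMEDEAN CLASS OF A LEVI-ADAPTED STANDARD DATUM.**  If `𝒦₁` is standard and LEVI-ADAPTED — for every Levi chart `Λ` (block
equation of ★ α3-2 ∕ ★ `exists_leviHom`) `Λ(K_{GL_n}) ⊆ 𝒦₁.K` (LH4-p17's `exists_isStd_leviAdapted`) — and `𝒦'` has the same archimedean trace as `𝒦₁` (★ p862794's class), then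
for every such `Λ` and every `k ∈ K_{GL_n}`, `((Λ k)_∞, 1) ∈ 𝒦'.K`: the letter `hadapt` of ★ ED. 6 `exists_middleTerm_package_of_standard_arch` for `𝒦'` (at `n = 2` verbatim).
[cite: BorelJacquet1979, §1.1, §4.1] [cite: MoeglinWaldspurger1995, II.1.7] [cite: PlatonovRapinchuk1994, §5.1] -/
theorem hadapt_of_leviAdapted {𝒦₁ : IwasawaDatum L e dV hdV dW hdW} (h₁ : 𝒦₁.IsStd)
    (hlev : ∀ (Λ : GL (Fin n) (AdeleRing (𝓞 L) L) →* HA L e dV hdV dW hdW),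
      (∀ g : GL (Fin n) (AdeleRing (𝓞 L) L), blk L e dV hdV dW hdW (Λ g) =
        cayR (AdeleRing (𝓞 L) L) (Fin n) * Matrix.fromBlocks (g : Matrix (Fin n) (Fin n) (AdeleRing (𝓞 L) L)) 0 0
          (((gramR L e dV hdV dW hdW).map ((algebraMap L (AdeleRing (𝓞 L) L)).comp (algebraMap (Fp L) L)))⁻¹ *
            (((g⁻¹ : GL (Fin n) (AdeleRing (𝓞 L) L)) : Matrix (Fin n) (Fin n) (AdeleRing (𝓞 L) L)).map
              (conjAdele (Fp L) L (IsCMField.complexConj L)))ᵀ *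
            (gramR L e dV hdV dW hdW).map ((algebraMap L (AdeleRing (𝓞 L) L)).comp (algebraMap (Fp L) L))) *
          cayRinv (AdeleRing (𝓞 L) L) (Fin n)) →
      ∀ k : GL (Fin n) (AdeleRing (𝓞 L) L), k ∈ standardMaximalCompactGL n L → Λ k ∈ 𝒦₁.K)
    {𝒦' : IwasawaDatum L e dV hdV dW hdW}
    (harch : ∀ a : UnitaryGroup.arch (Fp L) L (IsCMField.complexConj L) (n + n) (hermD L e dV hdV dW hdW),
      (UnitaryGroup.archToAdelic (Fp L) L (IsCMField.complexConj L) (n + n) (hermD L e dV hdV dW hdW) a : HA L e dV hdV dW hdW) ∈ 𝒦'.K ↔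
        (UnitaryGroup.archToAdelic (Fp L) L (IsCMField.complexConj L) (n + n) (hermD L e dV hdV dW hdW) a : HA L e dV hdV dW hdW) ∈ 𝒦₁.K) :
    ∀ (Λ : GL (Fin n) (AdeleRing (𝓞 L) L) →* HA L e dV hdV dW hdW),
      (∀ g : GL (Fin n) (AdeleRing (𝓞 L) L), blk L e dV hdV dW hdW (Λ g) =
        cayR (AdeleRing (𝓞 L) L) (Fin n) * Matrix.fromBlocks (g : Matrix (Fin n) (Fin n) (AdeleRing (𝓞 L) L)) 0 0
          (((gramR L e dV hdV dW hdW).map ((algebraMap L (AdeleRing (𝓞 L) L)).comp (algebraMap (Fp L) L)))⁻¹ *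
            (((g⁻¹ : GL (Fin n) (AdeleRing (𝓞 L) L)) : Matrix (Fin n) (Fin n) (AdeleRing (𝓞 L) L)).map
              (conjAdele (Fp L) L (IsCMField.complexConj L)))ᵀ *
            (gramR L e dV hdV dW hdW).map ((algebraMap L (AdeleRing (𝓞 L) L)).comp (algebraMap (Fp L) L))) *
          cayRinv (AdeleRing (𝓞 L) L) (Fin n)) →
      ∀ k : ↥(standardMaximalCompactGL n L),
        (UnitaryGroup.archToAdelic (Fp L) L (IsCMField.complexConj L) (n + n) (hermD L e dV hdV dW hdW)
          (UnitaryGroup.archPart (Fp L) L (IsCMField.complexConj L) (n + n) (hermD L e dV hdV dW hdW) (Λ (k : GL (Fin n) (AdeleRing (𝓞 L) L)))) :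
            HA L e dV hdV dW hdW) ∈ 𝒦'.K :=
  fun Λ hΛ => arch_mem_of_full L e dV hdV dW hdW h₁ Λ (hlev Λ hΛ) harch

end Summit.HodgeConjecture.HodgeConjecture.Cruxes.HLiu418.K2LiuLeviAdaptedDatumArchK

end
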